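import Mathlib
import Summits.AtomisticToContinuum.Crystallization.Theorems.GappedShellCensusCleanLimitsHaveWindowsLayeredHexagon
import Summits.AtomisticToContinuum.Crystallization.Theorems.GappedShellCensusCleanLimitsHaveWindowsLayeredInplaneHexagon

/-!
# Exactly layered shells ⇒ exactly layered set, file 4: the in-plane step at a rigid site

Crux `GappedShellCensus.CleanLimitsHaveWindows` (stmt-AtomisticToContinuum-15932), line `Sketch`, support for
`stub_layeredOfExactShells`.  Anchors `stub_inplaneStepC`, `stub_inplaneStepH` (both from the type-uniform
`inplaneStep_of_type`): at a rigid site `p` (hexagonal type, or cubic type with not both heights ideal) with shell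
`p + A·slotX(a', h⁺, h⁻)`, the in-plane neighbour `q = p + A u` has shell `q + A·slotX(a', h⁺, h⁻)` — same frame,
type and heights.  Proof: the hexagon of `q` in the frame `A` is in `Z` (`stub_inplaneHexagon` plus three shell
points of `p`), so by the hexagon lemma the shell of `q` is `q + B·slotY(a', k⁺, k⁻)` with `B e₃ = A e₃`, `B = ±A`
on the plane; the upper cap point `p + A (w + h⁺e₃) = q + A (w - u + h⁺e₃)` of `p` is a shell point of `q` of
positive height, which forces `k⁺ = h⁺` and `B = A`, and the lower cap point of `p` near `q` forces `k⁻ = h⁻` and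
`Y = X`.
-/

noncomputable section

namespace Summit.AtomisticToContinuum.Crystallization.Theorems.CleanHull

open Literature.MathematicalPhysics.StatisticalMechanics

/-- Cap codes: a level-`1` code has planar part `(1,1)`, `(-2,1)` or `(1,-2)` (never `(2,-1)`), and the planar part
of the lower cap code `9`/`10` of type `t` occurs at level `-1` only in type `t`. [folklore] -/
theorem la_cap_code_facts (t Y : Bool) (m : Fin 12) :
    ((laCode Y m).2.2 = 1 → ¬ ((laCode Y m).1 = 2 ∧ (laCode Y m).2.1 = -1)) ∧
    ((laCode Y m).2.2 = -1 → (laCode Y m).1 = (laCode t (if t then 9 else 10)).1 →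
      (laCode Y m).2.1 = (laCode t (if t then 9 else 10)).2.1 → Y = t) := by
  revert m Y t; decide

/-- A frame that agrees with `A` on `u, v, e₃` agrees with `A` on every code point. [folklore] -/
theorem la_frame_eq_on_laPt {a' kp km : ℝ} {A B : EuclideanSpace ℝ (Fin 3) →ₗᵢ[ℝ] EuclideanSpace ℝ (Fin 3)}
    (he : B (layerNormal 1) = A (layerNormal 1)) (hu : B (triangularVec₁ a') = A (triangularVec₁ a'))
    (hv : B (triangularVec₂ a') = A (triangularVec₂ a')) (c : ℤ × ℤ × ℤ) :
    B (laPt a' kp km c) = A (laPt a' kp km c) := by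
  simp only [laPt, map_add, LinearIsometry.map_smul, he, hu, hv]

/-- **In-plane step, both types at once** (`t` = type, rigidity required for cubic type). [folklore] -/
theorem inplaneStep_of_type (Z : Set (EuclideanSpace ℝ (Fin 3))) (a : ℝ) (ha : 0 < a)
    (hgap : ∀ y ∈ Z, ∀ w ∈ Z, w ≠ y → a * (1 - 1 / 50) ≤ dist y w ∧
      (dist y w ≤ a * (1 + 1 / 50) ∨ a * (63 / 50) ≤ dist y w))
    (hexact : ∀ p ∈ Z, ∃ (a' hp' hm' : ℝ) (A : EuclideanSpace ℝ (Fin 3) →ₗᵢ[ℝ] EuclideanSpace ℝ (Fin 3)),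
      0 < a' ∧ 0 < hp' ∧ 0 < hm' ∧
      ((bondShell a Z p = Set.range fun k : Fin 12 => p + A (slotC a' hp' hm' k)) ∨
       (bondShell a Z p = Set.range fun k : Fin 12 => p + A (slotH a' hp' hm' k))))
    (p : EuclideanSpace ℝ (Fin 3)) (hp : p ∈ Z) (a' hp' hm' : ℝ)
    (A : EuclideanSpace ℝ (Fin 3) →ₗᵢ[ℝ] EuclideanSpace ℝ (Fin 3)) (ha' : 0 < a') (hhp : 0 < hp') (hhm : 0 < hm')
    (t : Bool) (hS : bondShell a Z p = Set.range fun k : Fin 12 => p + A (laSlot t a' hp' hm' k))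
    (hrig : t = true → ¬ (3 * hp' ^ 2 = 2 * a' ^ 2 ∧ 3 * hm' ^ 2 = 2 * a' ^ 2)) :
    bondShell a Z (p + A (triangularVec₁ a')) =
      Set.range fun k : Fin 12 => p + A (triangularVec₁ a') + A (laSlot t a' hp' hm' k) := by
  -- the far hexagon points of `q`, the band at `p`, the points of `p`'s shell
  have hfar := inplaneHexagon_of_type Z a ha hgap hexact p hp a' hp' hm' A ha' hhp hhm t _ _ rfl rfl hS hrig
  obtain ⟨x1, x2, x3⟩ := hfar
  have hSor : (bondShell a Z p = Set.range fun k : Fin 12 => p + A (slotC a' hp' hm' k)) ∨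
      (bondShell a Z p = Set.range fun k : Fin 12 => p + A (slotH a' hp' hm' k)) := by
    cases t
    · exact Or.inr hS
    · exact Or.inl hS
  obtain ⟨-, hhi, -, hphi, -, hmhi⟩ := stub_exactBand Z a ha hgap p hp a' hp' hm' A ha' hhp hhm hSor
  have hP : ∀ k, p + A (laSlot t a' hp' hm' k) ∈ Z := fun k => by
    have h : p + A (laSlot t a' hp' hm' k) ∈ bondShell a Z p := hS ▸ ⟨k, rfl⟩
    exact h.1
  obtain ⟨f0, -, f3, f5, d4, d2, d6, dq⟩ := la_known_slot_facts t _ _ rfl rfl a' hp' hm'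
  obtain ⟨q, hq⟩ : ∃ q, q = p + A (triangularVec₁ a') := ⟨_, rfl⟩
  rw [← hq]
  have hqZ : q ∈ Z := by rw [hq, ← f0]; exact hP 0
  obtain ⟨nu, nv, duv⟩ := la_norm_uv ha'
  -- membership in the shell of `q` from the offset
  have memq : ∀ x : EuclideanSpace ℝ (Fin 3), 0 < ‖x‖ → ‖x‖ ≤ a * (1 + 1 / 50) → q + A x ∈ Z →
      q + A x ∈ bondShell a Z q := by
    intro x hx0 hx1 hZ
    refine ⟨hZ, fun e => ?_, ?_⟩
    · have h0 : A x = 0 := add_eq_left.1 e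
      rw [← A.norm_map, h0, norm_zero] at hx0; exact lt_irrefl _ hx0
    · rw [dist_eq_norm, sub_add_cancel_left, norm_neg, A.norm_map]; exact hx1
  have nuv : ‖triangularVec₁ a' - triangularVec₂ a'‖ = a' := by rw [← dist_eq_norm, duv]
  -- the hexagon of `q`
  have H1 : q + A (triangularVec₁ a') ∈ bondShell a Z q :=
    memq _ (by rw [nu]; exact ha') (by rw [nu]; exact hhi) (by rw [hq, add_assoc, ← map_add, ← two_smul ℝ]; exact x1)
  have H2 : q - A (triangularVec₁ a') ∈ bondShell a Z q := by
    rw [sub_eq_add_neg, ← map_neg]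
    exact memq _ (by rw [norm_neg, nu]; exact ha') (by rw [norm_neg, nu]; exact hhi)
      (by rw [hq, map_neg, add_neg_cancel_right]; exact hp)
  have H3 : q + A (triangularVec₂ a') ∈ bondShell a Z q :=
    memq _ (by rw [nv]; exact ha') (by rw [nv]; exact hhi) (by rw [hq, add_assoc, ← map_add]; exact x2)
  have H4 : q - A (triangularVec₂ a') ∈ bondShell a Z q := by
    rw [sub_eq_add_neg, ← map_neg]
    refine memq _ (by rw [norm_neg, nv]; exact ha') (by rw [norm_neg, nv]; exact hhi) ?_
    have e : q + A (-triangularVec₂ a') = p + A (laSlot t a' hp' hm' 4) := by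
      rw [hq, sub_eq_iff_eq_add'.1 d4, f0, f3, map_add, add_assoc]
    rw [e]; exact hP 4
  have H5 : q + A (triangularVec₁ a' - triangularVec₂ a') ∈ bondShell a Z q :=
    memq _ (by rw [nuv]; exact ha') (by rw [nuv]; exact hhi)
      (by rw [hq, add_assoc, ← map_add, show triangularVec₁ a' + (triangularVec₁ a' - triangularVec₂ a') =
        (2 : ℝ) • triangularVec₁ a' - triangularVec₂ a' by rw [two_smul]; abel]; exact x3)
  have H6 : q - A (triangularVec₁ a' - triangularVec₂ a') ∈ bondShell a Z q := by
    rw [sub_eq_add_neg, ← map_neg]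
    refine memq _ (by rw [norm_neg, nuv]; exact ha') (by rw [norm_neg, nuv]; exact hhi) ?_
    have e : q + A (-(triangularVec₁ a' - triangularVec₂ a')) = p + A (laSlot t a' hp' hm' 2) := by
      rw [show -(triangularVec₁ a' - triangularVec₂ a') = triangularVec₂ a' - triangularVec₁ a' by abel, hq,
        sub_eq_iff_eq_add'.1 d2, f0, f5, map_add, add_assoc]
    rw [e]; exact hP 2
  -- the hexagon lemma at `q`
  obtain ⟨b, kp, km, A', hb0, hkp, hkm, hSq⟩ := hexact q hqZ
  obtain ⟨kp', km', B, hkp', hkm', hBe, hBuv, hSB⟩ :=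
    stub_hexagonShell (bondShell a Z q) q b kp km A' hb0 hkp hkm hSq a' A ha' H1 H2 H3 H4 H5 H6
  obtain ⟨Y, hSY⟩ : ∃ Y : Bool, bondShell a Z q = Set.range fun k : Fin 12 => q + B (laPt a' kp' km' (laCode Y k)) := by
    rcases hSB with h | h
    · exact ⟨true, by rw [h]; exact congrArg _ (funext fun i => by rw [slotC_eq_laPt]; rfl)⟩
    · exact ⟨false, by rw [h]; exact congrArg _ (funext fun i => by rw [slotH_eq_laPt]; rfl)⟩
  obtain ⟨σ, hσ, hBu, hBv⟩ : ∃ σ : ℝ, (σ = 1 ∨ σ = -1) ∧ B (triangularVec₁ a') = σ • A (triangularVec₁ a') ∧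
      B (triangularVec₂ a') = σ • A (triangularVec₂ a') := by
    rcases hBuv with ⟨h1, h2⟩ | ⟨h1, h2⟩
    · exact ⟨1, Or.inl rfl, by rw [h1, one_smul], by rw [h2, one_smul]⟩
    · exact ⟨-1, Or.inr rfl, by rw [h1, neg_one_smul], by rw [h2, neg_one_smul]⟩
  have hBpt : ∀ c : ℤ × ℤ × ℤ, B (laPt a' kp' km' c) =
      A ((σ * ((c.1 : ℝ) / 3)) • triangularVec₁ a' + (σ * ((c.2.1 : ℝ) / 3)) • triangularVec₂ a' +
        laHt kp' km' c.2.2 • layerNormal 1) := by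
    intro c
    simp only [laPt, map_add, LinearIsometry.map_smul, hBe, hBu, hBv, smul_smul, mul_comm]
  obtain ⟨ht0, ht1, ht2⟩ := laHt_values kp' km'
  have lvY : ∀ m, (laCode Y m).2.2 = 0 ∨ (laCode Y m).2.2 = 1 ∨ (laCode Y m).2.2 = -1 := fun m => by
    rcases laCode_level Y m with h | h | h
    exacts [Or.inl h.1, Or.inr (Or.inl h.1), Or.inr (Or.inr h.1)]
  -- the upper cap point of `p` near `q`: `k⁺ = h⁺` and `B = A` on the plane
  have e67 : p + A (laSlot t a' hp' hm' 6) = q + A (laSlot t a' hp' hm' 7) := by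
    rw [hq, sub_eq_iff_eq_add'.1 d6, f0, map_add, add_assoc]
  have hcap : q + A (laSlot t a' hp' hm' 7) ∈ bondShell a Z q := by
    rw [laSlot_eq_laPt]
    obtain ⟨h0, h1⟩ := la_norm_bounds ⟨ha, hhp, hhm, stub_exactBand Z a ha hgap p hp a' hp' hm' A ha' hhp hhm hSor⟩ t 7
    exact memq _ h0 h1 (by rw [← laSlot_eq_laPt, ← e67]; exact hP 6)
  rw [hSY] at hcap
  obtain ⟨m, hmm⟩ := hcap
  have hmm' : B (laPt a' kp' km' (laCode Y m)) = A (laPt a' hp' hm' (laCode t 7)) := by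
    rw [laSlot_eq_laPt] at hmm; simpa using hmm
  have c7 : laCode t 7 = (-2, 1, 1) := by cases t <;> rfl
  rw [hBpt, c7, (laPt_coords a' hp' hm' _).1] at hmm'
  obtain ⟨e1, e2, e3⟩ := la_coords ha'.ne' (A.injective hmm')
  have r3 : laHt hp' hm' ((-2, 1, 1) : ℤ × ℤ × ℤ).2.2 = hp' := by simp [laHt]
  have r1 : ((((-2, 1, 1) : ℤ × ℤ × ℤ).1 : ℤ) : ℝ) = -2 := by norm_num
  have r2 : ((((-2, 1, 1) : ℤ × ℤ × ℤ).2.1 : ℤ) : ℝ) = 1 := by norm_num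
  rw [r3] at e3
  rw [r1] at e1
  rw [r2] at e2
  have hlm : (laCode Y m).2.2 = 1 ∧ kp' = hp' := by
    rcases lvY m with h | h | h
    · rw [h, ht0] at e3; linarith
    · rw [h, ht1] at e3; exact ⟨h, e3⟩
    · rw [h, ht2] at e3; linarith
  have hσ1 : σ = 1 := by
    rcases hσ with h | h
    · exact h
    · exfalso
      rw [h] at e1 e2
      have p1 : (laCode Y m).1 = 2 := by exact_mod_cast (by linarith : ((laCode Y m).1 : ℝ) = 2)
      have p2 : (laCode Y m).2.1 = -1 := by exact_mod_cast (by linarith : ((laCode Y m).2.1 : ℝ) = -1)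
      exact (la_cap_code_facts t Y m).1 hlm.1 ⟨p1, p2⟩
  rw [hσ1, one_smul] at hBu hBv
  obtain ⟨hl1, rfl⟩ := hlm
  -- the lower cap point of `p` near `q`: `k⁻ = h⁻` and `Y = t`
  have eq9 : p + A (laSlot t a' kp' hm' (if t then 10 else 9)) = q + A (laSlot t a' kp' hm' (if t then 9 else 10)) := by
    rw [hq, sub_eq_iff_eq_add'.1 dq, f0, map_add, add_assoc]
  have hlow : q + A (laSlot t a' kp' hm' (if t then 9 else 10)) ∈ bondShell a Z q := by
    rw [laSlot_eq_laPt]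
    obtain ⟨h0, h1⟩ := la_norm_bounds ⟨ha, hhp, hhm, stub_exactBand Z a ha hgap p hp a' kp' hm' A ha' hhp hhm hSor⟩ t
      (if t then 9 else 10)
    exact memq _ h0 h1 (by rw [← laSlot_eq_laPt, ← eq9]; exact hP _)
  rw [hSY] at hlow
  obtain ⟨n, hnn⟩ := hlow
  have hnn' : B (laPt a' kp' km' (laCode Y n)) = A (laPt a' kp' hm' (laCode t (if t then 9 else 10))) := by
    rw [laSlot_eq_laPt] at hnn; simpa using hnn
  rw [hBpt, hσ1, (laPt_coords a' kp' hm' _).1] at hnn'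
  obtain ⟨e1, e2, e3⟩ := la_coords ha'.ne' (A.injective hnn')
  have lkn : (laCode t (if t then 9 else 10)).2.2 = -1 := by cases t <;> rfl
  have r3 : laHt kp' hm' (laCode t (if t then 9 else 10)).2.2 = -hm' := by rw [lkn]; simp [laHt]
  rw [r3] at e3
  rw [one_mul] at e1 e2
  have hln : (laCode Y n).2.2 = -1 ∧ km' = hm' := by
    rcases lvY n with h | h | h
    · rw [h, ht0] at e3; linarith
    · rw [h, ht1] at e3; linarith
    · rw [h, ht2] at e3; exact ⟨h, by linarith⟩
  obtain ⟨hln1, rfl⟩ := hln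
  have p1 : (laCode Y n).1 = (laCode t (if t then 9 else 10)).1 := by
    exact_mod_cast (by linarith : ((laCode Y n).1 : ℝ) = (laCode t (if t then 9 else 10)).1)
  have p2 : (laCode Y n).2.1 = (laCode t (if t then 9 else 10)).2.1 := by
    exact_mod_cast (by linarith : ((laCode Y n).2.1 : ℝ) = (laCode t (if t then 9 else 10)).2.1)
  have hYt : Y = t := (la_cap_code_facts t Y n).2 hln1 p1 p2
  subst hYt
  -- conclusion
  rw [hSY]
  exact congrArg _ (funext fun k => by rw [laSlot_eq_laPt, la_frame_eq_on_laPt hBe hBu hBv])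

/-- **In-plane step, cubic type.** [folklore] -/
theorem stub_inplaneStepC (Z : Set (EuclideanSpace ℝ (Fin 3))) (a : ℝ) (ha : 0 < a)
    (hgap : ∀ y ∈ Z, ∀ w ∈ Z, w ≠ y → a * (1 - 1 / 50) ≤ dist y w ∧
      (dist y w ≤ a * (1 + 1 / 50) ∨ a * (63 / 50) ≤ dist y w))
    (hexact : ∀ p ∈ Z, ∃ (a' hp' hm' : ℝ) (A : EuclideanSpace ℝ (Fin 3) →ₗᵢ[ℝ] EuclideanSpace ℝ (Fin 3)),
      0 < a' ∧ 0 < hp' ∧ 0 < hm' ∧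
      ((bondShell a Z p = Set.range fun k : Fin 12 => p + A (slotC a' hp' hm' k)) ∨
       (bondShell a Z p = Set.range fun k : Fin 12 => p + A (slotH a' hp' hm' k))))
    (p : EuclideanSpace ℝ (Fin 3)) (hp : p ∈ Z) (a' hp' hm' : ℝ)
    (A : EuclideanSpace ℝ (Fin 3) →ₗᵢ[ℝ] EuclideanSpace ℝ (Fin 3)) (ha' : 0 < a') (hhp : 0 < hp') (hhm : 0 < hm')
    (hrig : ¬ (3 * hp' ^ 2 = 2 * a' ^ 2 ∧ 3 * hm' ^ 2 = 2 * a' ^ 2))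
    (hS : bondShell a Z p = Set.range fun k : Fin 12 => p + A (slotC a' hp' hm' k)) :
    bondShell a Z (p + A (triangularVec₁ a')) =
      Set.range fun k : Fin 12 => p + A (triangularVec₁ a') + A (slotC a' hp' hm' k) :=
  inplaneStep_of_type Z a ha hgap hexact p hp a' hp' hm' A ha' hhp hhm true hS fun _ => hrig

/-- **In-plane step, hexagonal type.** [folklore] -/
theorem stub_inplaneStepH (Z : Set (EuclideanSpace ℝ (Fin 3))) (a : ℝ) (ha : 0 < a)
    (hgap : ∀ y ∈ Z, ∀ w ∈ Z, w ≠ y → a * (1 - 1 / 50) ≤ dist y w ∧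
      (dist y w ≤ a * (1 + 1 / 50) ∨ a * (63 / 50) ≤ dist y w))
    (hexact : ∀ p ∈ Z, ∃ (a' hp' hm' : ℝ) (A : EuclideanSpace ℝ (Fin 3) →ₗᵢ[ℝ] EuclideanSpace ℝ (Fin 3)),
      0 < a' ∧ 0 < hp' ∧ 0 < hm' ∧
      ((bondShell a Z p = Set.range fun k : Fin 12 => p + A (slotC a' hp' hm' k)) ∨
       (bondShell a Z p = Set.range fun k : Fin 12 => p + A (slotH a' hp' hm' k))))
    (p : EuclideanSpace ℝ (Fin 3)) (hp : p ∈ Z) (a' hp' hm' : ℝ)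
    (A : EuclideanSpace ℝ (Fin 3) →ₗᵢ[ℝ] EuclideanSpace ℝ (Fin 3)) (ha' : 0 < a') (hhp : 0 < hp') (hhm : 0 < hm')
    (hS : bondShell a Z p = Set.range fun k : Fin 12 => p + A (slotH a' hp' hm' k)) :
    bondShell a Z (p + A (triangularVec₁ a')) =
      Set.range fun k : Fin 12 => p + A (triangularVec₁ a') + A (slotH a' hp' hm' k) :=
  inplaneStep_of_type Z a ha hgap hexact p hp a' hp' hm' A ha' hhp hhm false hS fun h => absurd h Bool.false_ne_true

end Summit.AtomisticToContinuum.Crystallization.Theorems.CleanHull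

end
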